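import Summits.BirchSwinnertonDyer.BirchSwinnertonDyer.Theorems.KimAtThreeShallowEqDeepZetaBodyScaling
import HarnessLib

/-!
# `ZetaBody` is homogeneous in `(κ, Λ, x)` under every RATIONAL scalar (cell `bsd-addord`, seat w2-c2 gen 9;
# route W2 `KimAtThreeKolyvagin`; `--supports stmt-BirchSwinnertonDyer-19075`, helper)

HONEST FRAMING.  TOOL theorem (no definition, no named fact, no `sorry`); Kato's cited matrix `ZetaBody` enters as
the displayed HYPOTHESIS `hbody`; closes nothing; nothing booked; BSD is not proved by any of this.

w2-c4 g8's `KimAtThreeShallowEqDeepZetaBodyScaling.zetaBody_smul` scales Kato's witnesses `(κ, Λ, x)` by a natural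
number.  THIS FILE: the same for an arbitrary rational `q` (`κ ↦ q·κ`, `Λ ↦ (q : ℚ_p) • Λ`, `x ↦ q • x`; classes `z`
untouched) — (C1)/(C2) do not mention them, (C3a)/(C3b)/(C4) are `ℚ_p`-linear, (C5) is `ℚ`-linear in `x` on the left
and in `κ` on the right.  Used by this seat's `KimAtThreeDeepLowerKatoPartsRescale` with `q = 3^{-n}`, `n ∈ ℤ`: the
`3`-power part of the discrepancy between a duality-normalised Néron line datum and Kato's rational one is absorbed
by Kato's witnesses, the unit part by the line datum.
References: K. Kato, Astérisque 295 (2004) Thm. 9.7 (p. 189), Thm. 6.6 (1) (p. 163) [Kato2004Asterisque].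
-/

noncomputable section

-- the Theorems namespace of a single-conjunct summit repeats the summit name by design (D-0017)
set_option linter.dupNamespace false

open scoped BigOperators NumberField TensorProduct
open Finset IsDedekindDomain NumberField Field WeierstrassCurve Rat.HeightOneSpectrum
open Literature.NumberTheory.GaloisRepresentations Literature.NumberTheory.GaloisCohomology
open Literature.NumberTheory.EllipticCurves Literature.NumberTheory.EllipticCurves.ModularForms
open Literature.NumberTheory.EllipticCurves.Kato2004
open Literature.NumberTheory.EllipticCurves.Kato2004.EulerSystemValues
open Summit.BirchSwinnertonDyer.Rank1Residual.GaloisImage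

namespace Summit.BirchSwinnertonDyer.BirchSwinnertonDyer.Theorems.KimAtThreeDeepLowerZetaBodyRatScaling

section Scaling

variable {W : WeierstrassCurve ℚ} [W.IsElliptic] {p : ℕ} [Fact p.Prime]
  [ContinuousSMul ℤ_[p] (W.tateModule p)] [Module.Free ℤ_[p] (W.tateModule p)]
  [Module.Finite ℤ_[p] (W.tateModule p)] {N : ℕ} {f : CuspForm (CongruenceSubgroup.Gamma0 N) 2}
  {ι : (m : ℕ) → (CyclotomicField m ℚ →+* ℂ)} {κ : ℝ}
  {Λ : ∀ (k : ℕ) (r : Finset (HeightOneSpectrum (𝓞 ℚ))),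
    H1 (tateRep W p) (cycSubgroup p k r) →ₗ[ℤ_[p]] ℚ_[p] ⊗[ℚ] CyclotomicField (cycLevel p k r) ℚ}
  {c d a : ℤ} {A : ℕ}
  {z : ∀ (k : ℕ) (r : (cyclotomicLevelsRat p (badPlaces c d A N)).Ideals),
    H1 (tateRep W p) ((cyclotomicLevelsRat p (badPlaces c d A N)).level k r.1)}
  {x : ∀ (k : ℕ) (r : (cyclotomicLevelsRat p (badPlaces c d A N)).Ideals),
    CyclotomicField (cycLevel p k r.1) ℚ}

/-- Kato's character sum is `ℚ`-linear in the value: `Σ_b χ(b) ι(σ_b (q·x)) = q · Σ_b χ(b) ι(σ_b x)` for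
`q ∈ ℚ`. [folklore] -/
theorem charSum_rat_smul (n : ℕ) [NeZero n] (ι₀ : CyclotomicField n ℚ →+* ℂ)
    (χ : DirichletCharacter ℂ n) (q : ℚ) (y : CyclotomicField n ℚ) :
    charSum n ι₀ χ (q • y) = (q : ℂ) * charSum n ι₀ χ y := by
  unfold charSum
  rw [Finset.mul_sum]
  refine Finset.sum_congr rfl fun b _ => ?_
  rw [Algebra.smul_def, map_mul, AlgEquiv.commutes, map_mul, eq_ratCast, map_ratCast]
  ring

/-- The left `ℚ_p`-action on `ℚ_p ⊗_ℚ K` commutes with `id ⊗ σ`. [folklore] -/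
theorem map_id_smul {K : Type*} [CommRing K] [Algebra ℚ K] (σ : K →ₐ[ℚ] K) (s : ℚ_[p]) (t : ℚ_[p] ⊗[ℚ] K) :
    Algebra.TensorProduct.map (AlgHom.id ℚ ℚ_[p]) σ (s • t) =
      s • Algebra.TensorProduct.map (AlgHom.id ℚ ℚ_[p]) σ t := by
  have hsmul : ∀ u : ℚ_[p] ⊗[ℚ] K, s • u = (s ⊗ₜ[ℚ] (1 : K)) * u := fun u => by
    rw [Algebra.smul_def]; rfl
  rw [hsmul, hsmul, map_mul, Algebra.TensorProduct.map_tmul, AlgHom.id_apply, map_one]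

set_option backward.isDefEq.respectTransparency false in
/-- **`ZetaBody` is homogeneous in `(κ, Λ, x)` under a rational scalar `q`** (classes `z` untouched):
(C1)/(C2) do not mention them, (C3a)/(C3b)/(C4) are linear, (C5) is linear in `x` on the left and in `κ` on the
right.  (`q = 0` is allowed: every clause degenerates consistently; the consumer uses `q = 3^{-n}`.)
[cite: Kato2004Asterisque, Thm. 9.7 (p. 189) and Thm. 6.6 (1) (p. 163)] -/
theorem zetaBody_rat_smul (q : ℚ) (hbody : ZetaBody W p f ι κ Λ c d a A z x) :
    ZetaBody W p f ι ((q : ℝ) * κ) (fun k r => (q : ℚ_[p]) • Λ k r) c d a A z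
      (fun k r => q • x k r) := by
  obtain ⟨h1, h2, h3a, h3b, h4, h5⟩ := hbody
  refine ⟨h1, h2, ?_, ?_, ?_, ?_⟩
  · intro k r σ y
    rw [LinearMap.smul_apply, LinearMap.smul_apply, h3a k r σ y, map_id_smul]
  · intro k r y hy
    rw [LinearMap.smul_apply, h3b k r y hy, smul_zero]
  · intro k r
    rw [LinearMap.smul_apply, h4 k r, TensorProduct.tmul_smul, ← algebraMap_smul ℚ_[p] q,
      Algebra.algebraMap_eq_smul_one, Rat.smul_one_eq_cast]
  · intro k r d' χ Lχ hcd hdd' hL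
    obtain ⟨heven, hodd⟩ := h5 k r d' χ Lχ hcd hdd' hL
    refine ⟨fun hχ => ?_, fun hχ => ?_⟩
    · rw [charSum_rat_smul, heven hχ]
      push_cast
      ring
    · rw [charSum_rat_smul, hodd hχ]
      push_cast
      ring

end Scaling

end Summit.BirchSwinnertonDyer.BirchSwinnertonDyer.Theorems.KimAtThreeDeepLowerZetaBodyRatScaling

end
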